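import Summits.BirchSwinnertonDyer.Rank1Residual.Additive.X4RankZeroVisibleRefinedCertificateSockets
import HarnessLib

/-!
# The LOWER-half record socket over the refined seven-kind certificate, the place `3` PAID, prime-list
# form — Kato-free, Tamagawa-free, class-free at `3`
# (cell `b2b-bsdres`, team n1011, row T-GSHARP FILE 5; seat p04 GEN 12; route planner 1 ST-51c:
# "LOWER records … so the visibility half is banked while (U-TAM) stays open")

HONEST FRAMING (cell `b2b-bsdres`, run/shared/lean/b2b/bsd-rank1-residual/, verbatim in every
file): the goal of the cell is to DELETE the COMBINATION-SHAPED residual classes of the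
Birch–Swinnerton-Dyer formula for ALL analytic-rank `≤ 1` elliptic curves over `ℚ` — "full BSD
formula for every rank `≤ 1` curve in class `C`" assembled STRICTLY from published theorems — so
that the rank-`≤ 1` remainder becomes exactly the CONSTRUCTION-SHAPED classes, which are TYPED
(missing-input `Prop`s), NOT attempted. This is not "finishing BSD". Team n1011 (N10 / N11, the
additive block X4 ∧ `p = 3`): research route on the CONSTRUCTION-SHAPED class X4; no claim beyond
the stated classes; nothing is booked; no mark / label / count is changed by this file. Theorems
only (no definition, no new named fact, no `sorry`). The socket is CONDITIONAL on the displayed named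
facts (Cassels–Tate `hCT`, Gross–Zagier–Kolyvagin `hGZK`, Tate uniformisation A40/A41 `hU`/`hU2`) and
CLOSES NOTHING by itself: it delivers the typed LOWER half `MissingLowerBoundAt W 3` only; a per-row
RECORD discharges `θ`, the integer models, `#E′(ℚ₃)[3] ≤ t` and every disjunct of `hplaces` in the
kernel and carries `hr`, `hq`/`hv`, `hrank` as EVIDENCE binders (n1011 lead R5-82 (d)).

## What

* §1 (every odd `p`): `RankZero.missingLowerBoundAt_of_exists_sha_torsion` (from ANY visible
  element of `Ш(E)[p]`), `RankZero.missingLowerBoundAt_of_congr_of_rank_two[_of_primeList]` (n1011-p03's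
  rank-two certificate / n1011-p18's prime-list adapter with the upper-half binders deleted);
* §2 `RankZero.missingLowerBoundAt_three_of_congr_of_places₇_of_primeList_paidThree` — T-2LL FILE 3's
  `Visible.missingLowerBoundAt_three_of_congr_of_places₇` through FILE 6's plumbing
  (`exists_placeFinset_of_primeList`, `exists_paidPlace_three`, `good_and_not_mem_of_not_mem_placeFinset`),
  binder order = FILE 6's `…_of_kato_of_primeList_paidThree` with the upper-half binders deleted.
A LOWER record over this socket becomes `BSD(E,3)` by ONE application of an upper half:
`X4RankZero.bsdp_of_missingLowerBoundAt_of_kato` (p03; `3 ∤ ∏ c_ℓ`), `…_of_katoSharp` /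
`…_of_katoSharp_of_casselsTate_of_tamDefect_le_one` (FILE 1 §1; reading / defect `≤ 1`), or the
Tamagawa-exact `X4RankZero.bsdp_of_missingLowerBoundAt_of_katoTam` (FILE 6, over lit-kato's A161″ —
NO Tamagawa / Manin / parity binder).

References: [CremonaMazur2000] §3 and Table 1; [AgasheStein2002] Thm. 3.1; [SilvermanAEC2009] X.4.14;
[SilvermanATAEC1994] Ch. V; [Miller2011LMS] Def. 1.1; cells/n1011/ROUTE-1.md §51 (ST-51c).
-/

set_option autoImplicit false

noncomputable section

open scoped Classical NumberField
open IsDedekindDomain NumberField WeierstrassCurve Rat.HeightOneSpectrum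
  Literature.NumberTheory.EllipticCurves Literature.NumberTheory.EllipticCurves.ModularForms
  Literature.NumberTheory.EllipticCurves.Rank1Residual
  Literature.NumberTheory.EllipticCurves.Rank1Residual.Typed
  Literature.NumberTheory.GaloisRepresentations
  Summit.BirchSwinnertonDyer.Rank1Residual.GaloisImage

namespace Summit.BirchSwinnertonDyer.Rank1Residual.Additive

/-! ### §1. Kind-agnostic and rank-two LOWER-half sockets, every odd `p` -/

section AnyOddPrime

variable (W : WeierstrassCurve ℚ) [W.IsElliptic] (p : ℕ) [Fact p.Prime]

/-- **LOWER half from ANY visible element of `Ш(E)[p]`** (the socket every lower-half producer — places,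
rank, identity-component index — can end in, with NO upper-half input): analytic rank `0` (so `Ш(E)`
is finite, GZK), `#Ш_an = q` with `ord_p q ≤ 2`, and `∃ c ∈ Ш(E)`, `c ≠ 0`, `p • c = 0` ⟹
`MissingLowerBoundAt W p` (`p ∣ #Ш`, `#Ш` a square by Cassels–Tate, so `p² ∣ #Ш ≥_p q`).
[cite: SilvermanAEC2009, Thm. X.4.14] [cite: Miller2011LMS, §1 and Def. 1.1] -/
theorem RankZero.missingLowerBoundAt_of_exists_sha_torsion
    (hCT : exists_casselsTate_pairing (K := ℚ))
    (hGZK : rank_eq_analyticRank_of_analyticRank_le_one)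
    (hr : W.analyticRank = 0) {q : ℚ} (hq : shaAn W = (q : ℂ)) (hv : padicValRat p q ≤ 2)
    (hvis : ∃ c : W.sha, c ≠ 0 ∧ p • c = 0) : MissingLowerBoundAt W p :=
  missingLowerBoundAt_of_casselsTate_of_pow_dvd W p hCT (hGZK W (by omega)).2 hq (k := 1)
    (by simpa using hv) (by simpa using dvd_shaOrder_of_exists_torsion W p hvis)

/-- **LOWER half from a `p`-congruent partner of rank `≥ 2` with `E′(ℚ_v)[p] = 0` on `S`** (n1011-p03's
rank-two certificate, `X4RankZero.bsdp_of_congr_of_rank_two_of_kato` WITHOUT its upper half): analytic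
rank `0`, `ρ̄_{E,p}` irreducible (for `p ∤ #E(ℚ)`), `#Ш_an = q` with `ord_p q ≤ 2` ⟹
`MissingLowerBoundAt W p`. [cite: CremonaMazur2000, §3 and Table 1] [cite: AgasheStein2002, Thm. 3.1]
[cite: SilvermanAEC2009, Thm. X.4.14] [cite: Miller2011LMS, §1 and Def. 1.1] -/
theorem RankZero.missingLowerBoundAt_of_congr_of_rank_two
    (hCT : exists_casselsTate_pairing (K := ℚ))
    (hGZK : rank_eq_analyticRank_of_analyticRank_le_one) (hp : p ≠ 2)
    (hr : W.analyticRank = 0) (hirr : Irr W p)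
    {q : ℚ} (hq : shaAn W = (q : ℂ)) (hv : padicValRat p q ≤ 2)
    (W' : WeierstrassCurve ℚ) [W'.IsElliptic]
    (θ : geomTorsion W' (p : ℤ) ≃+ geomTorsion W (p : ℤ))
    (hθ : ∀ (σ : Field.absoluteGaloisGroup ℚ) (P : geomTorsion W' (p : ℤ)), θ (σ • P) = σ • θ P)
    (hrank : 2 ≤ W'.mordellWeilRank) (S : Finset (HeightOneSpectrum (𝓞 ℚ)))
    (hS : ∀ v : HeightOneSpectrum (𝓞 ℚ), v ∉ S →
      W.HasGoodReductionAt v ∧ W'.HasGoodReductionAt v ∧ (p : 𝓞 ℚ) ∉ v.asIdeal)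
    (hloc : ∀ v ∈ S, Nat.card (nsmulAddMonoidHom p :
      (W'.baseChange (v.adicCompletion ℚ)).toAffine.Point →+ _).ker = 1) :
    MissingLowerBoundAt W p := by
  haveI : Finite W.toAffine.Point := finite_point_of_analyticRank_eq_zero W hGZK hr
  have hrank' : Module.finrank ℚ ℚ + 1 ≤ W'.mordellWeilRank := by rwa [Module.finrank_self]
  exact RankZero.missingLowerBoundAt_of_exists_sha_torsion W p hCT hGZK hr hq hv
    (W.exists_sha_ne_zero_of_congr_of_rank W' hp θ hθ S hS ‹_› (coprime_natCard_point_of_irr W p hirr)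
      hrank' hloc)

/-- **The rank-two LOWER-half socket with `S` = the places over a prime list `L ∋ p`** supporting both
integral discriminants (n1011-p18's adapter shape, upper-half binders deleted).
[cite: SilvermanAEC2009, VII.5 Prop. 5.1(a)] [cite: CremonaMazur2000, §3 and Table 1] [cite: Miller2011LMS, §1 and Def. 1.1] -/
theorem RankZero.missingLowerBoundAt_of_congr_of_rank_two_of_primeList
    (hCT : exists_casselsTate_pairing (K := ℚ))
    (hGZK : rank_eq_analyticRank_of_analyticRank_le_one) (hp : p ≠ 2)
    (hr : W.analyticRank = 0) (hirr : Irr W p)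
    {q : ℚ} (hq : shaAn W = (q : ℂ)) (hv : padicValRat p q ≤ 2)
    (W' : WeierstrassCurve ℚ) [W'.IsElliptic]
    (θ : geomTorsion W' (p : ℤ) ≃+ geomTorsion W (p : ℤ))
    (hθ : ∀ (σ : Field.absoluteGaloisGroup ℚ) (P : geomTorsion W' (p : ℤ)), θ (σ • P) = σ • θ P)
    (hrank : 2 ≤ W'.mordellWeilRank)
    {E₀ F₀ : WeierstrassCurve ℤ} (hE : E₀.map (Int.castRingHom ℚ) = W)
    (hF : F₀.map (Int.castRingHom ℚ) = W') (L : List ℕ) (hpL : p ∈ L)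
    (hΔE : ∀ q : ℕ, q.Prime → (q : ℤ) ∣ E₀.Δ → q ∈ L)
    (hΔF : ∀ q : ℕ, q.Prime → (q : ℤ) ∣ F₀.Δ → q ∈ L)
    (hloc : ∀ v : HeightOneSpectrum (𝓞 ℚ), (primesEquiv v : ℕ) ∈ L →
      Nat.card (nsmulAddMonoidHom p :
        (W'.baseChange (v.adicCompletion ℚ)).toAffine.Point →+ _).ker = 1) :
    MissingLowerBoundAt W p := by
  obtain ⟨S, hS⟩ := exists_placeFinset_of_primeList L
  exact RankZero.missingLowerBoundAt_of_congr_of_rank_two W p hCT hGZK hp hr hirr hq hv W' θ hθ hrank S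
    (good_and_not_mem_of_not_mem_placeFinset hE hF L (Fact.out : p.Prime) hpL hΔE hΔF hS)
    (fun v hvS ↦ hloc v ((hS v).mp hvS))

end AnyOddPrime

/-! ### §2. The refined seven-kind LOWER-half socket at `p = 3`, the place `3` PAID, prime-list form -/

/-- **LOWER-half record socket, the place `3` PAID, prime-list form — NO Kato fact, NO Tamagawa
binder, NO class hypothesis at `3`**: `MissingLowerBoundAt W 3` (`ord₃ #Ш_an ≤ ord₃ #Ш`) for a globally
minimal `E = W` of analytic rank `0` with `ρ̄_{E,3}` onto and `ord₃ #Ш_an ≤ 2`, from a `3`-congruent partner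
`E′ = W′` with `#E′(ℚ₃)[3] ≤ t`, `3t < 3^k`, `k ≤ rank E′(ℚ)`, every other place over `L ∋ 3` of one of
the seven kinds — FILE 6's `…_of_kato_of_primeList_paidThree` binder order with the UPPER-half binders
(`hKato hmod hX hpot hsurj-tower htam D hc`) DELETED and `hsurj : ρ̄_{E,3}` onto kept for `3 ∤ #E(ℚ)`.
Serves EVERY visibility row whatever its reduction at `3` and its Tamagawa numbers (route planner 1
ST-51c: the 26 rows of Tamagawa defect `≥ 2` / `ord₃ #Ш_an = 4` excepted by `hv`, and any (G)/(M) row as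
its banked LOWER half); an UPPER half (`X4RankZero.bsdp_of_missingLowerBoundAt_of_kato[Sharp][…]`,
FILE 1 §1; `…_of_katoTam`, FILE 6 over A161″, with NO Tamagawa binder) turns it into `BSD(E,3)` by one line. [cite: CremonaMazur2000, §3 and Table 1]
[cite: AgasheStein2002, Thm. 3.1] [cite: SilvermanAEC2009, Thm. X.4.14] [cite: Miller2011LMS, §1 and Def. 1.1] -/
theorem RankZero.missingLowerBoundAt_three_of_congr_of_places₇_of_primeList_paidThree
    (hCT : exists_casselsTate_pairing (K := ℚ))
    (hGZK : rank_eq_analyticRank_of_analyticRank_le_one)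
    (hU : Silverman1994_thmV53_tateUniformisation.{0})
    (hU2 : Silverman1994_thmV53_corV54_tateUniformisation.{0})
    (W : WeierstrassCurve ℚ) [W.IsElliptic] [W.IsGloballyMinimal]
    (hr : W.analyticRank = 0) (hsurj : W.HasSurjectiveModNGaloisRep 3)
    {q : ℚ} (hq : shaAn W = (q : ℂ)) (hv : padicValRat 3 q ≤ 2)
    (W' : WeierstrassCurve ℚ) [W'.IsElliptic]
    (θ : geomTorsion W' ((3 : ℕ) : ℤ) ≃+ geomTorsion W ((3 : ℕ) : ℤ))
    (hθ : ∀ (σ : Field.absoluteGaloisGroup ℚ) (P : geomTorsion W' ((3 : ℕ) : ℤ)),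
      θ (σ • P) = σ • θ P)
    {t k : ℕ} (htors₃ : ∀ w : HeightOneSpectrum (𝓞 ℚ), (primesEquiv w : ℕ) = 3 →
      Nat.card (nsmulAddMonoidHom 3 :
        (W'.baseChange (w.adicCompletion ℚ)).toAffine.Point →+ _).ker ≤ t)
    (hbudget : 3 * t < 3 ^ k) (hrank : k ≤ W'.mordellWeilRank)
    {E₀ F₀ : WeierstrassCurve ℤ} (hE : E₀.map (Int.castRingHom ℚ) = W)
    (hF : F₀.map (Int.castRingHom ℚ) = W') (L : List ℕ) (h3L : 3 ∈ L)
    (hΔE : ∀ q : ℕ, q.Prime → (q : ℤ) ∣ E₀.Δ → q ∈ L)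
    (hΔF : ∀ q : ℕ, q.Prime → (q : ℤ) ∣ F₀.Δ → q ∈ L)
    (hplaces : ∀ w : HeightOneSpectrum (𝓞 ℚ), (primesEquiv w : ℕ) ∈ L → (primesEquiv w : ℕ) ≠ 3 →
      (((3 : ℕ) : 𝓞 ℚ) ∉ w.asIdeal ∧ Nat.card (nsmulAddMonoidHom 3 :
          (W'.baseChange (w.adicCompletion ℚ)).toAffine.Point →+ _).ker = 1) ∨
      (W.HasSplitMultiplicativeReductionAt w ∧ W'.HasSplitMultiplicativeReductionAt w ∧
        Nat.card (nsmulAddMonoidHom 3 :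
          (W.baseChange (w.adicCompletion ℚ)).toAffine.Point →+ _).ker ≤ 3) ∨
      (W.HasMultiplicativeReductionAt w ∧ W'.HasMultiplicativeReductionAt w ∧
        (∃ r : w.adicCompletion ℚ, algebraMap ℚ (w.adicCompletion ℚ) (-(W.c₄ / W.c₆)) =
          r ^ 2 * algebraMap ℚ (w.adicCompletion ℚ) (-(W'.c₄ / W'.c₆))) ∧
        (∀ ζ : w.adicCompletion ℚ, ζ ^ 3 = 1 → ζ = 1)) ∨
      (W.HasMultiplicativeReductionAt w ∧
        ¬ IsSquare (algebraMap ℚ (w.adicCompletion ℚ) (-(W.c₄ / W.c₆))) ∧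
        W'.HasGoodReductionAt w ∧ ((3 : ℕ) : 𝓞 ℚ) ∉ w.asIdeal) ∨
      (W.HasGoodReductionAt w ∧ W'.HasMultiplicativeReductionAt w ∧
        ¬ IsSquare (algebraMap ℚ (w.adicCompletion ℚ) (-(W'.c₄ / W'.c₆))) ∧
        ((3 : ℕ) : 𝓞 ℚ) ∉ w.asIdeal) ∨
      (1 < w.valuation ℚ W.j ∧ 1 < w.valuation ℚ W'.j ∧
        (∃ r : w.adicCompletion ℚ, algebraMap ℚ (w.adicCompletion ℚ) (-(W.c₄ / W.c₆)) =
          r ^ 2 * algebraMap ℚ (w.adicCompletion ℚ) (-(W'.c₄ / W'.c₆))) ∧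
        (∀ ζ : w.adicCompletion ℚ, ζ ^ 3 = 1 → ζ = 1)) ∨
      (W.HasAdditiveReductionAt w ∧ W'.HasAdditiveReductionAt w ∧ ((3 : ℕ) : 𝓞 ℚ) ∉ w.asIdeal ∧
        Nat.card (nsmulAddMonoidHom 3 :
          (W'.baseChange (w.adicCompletion ℚ)).toAffine.Point →+ _).ker = 3)) :
    haveI : Fact (Nat.Prime 3) := ⟨Nat.prime_three⟩
    MissingLowerBoundAt W 3 := by
  haveI : Fact (Nat.Prime 3) := ⟨Nat.prime_three⟩
  obtain ⟨S, hS⟩ := exists_placeFinset_of_primeList L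
  obtain ⟨T, hTS, hT, hT3⟩ := exists_paidPlace_three W' L h3L hS htors₃ hbudget hrank
  have hfin : Finite W.toAffine.Point := finite_point_of_analyticRank_eq_zero W hGZK hr
  have hSha : W.ShaFinite := (hGZK W (by rw [hr]; exact zero_le_one)).2
  have hirr : Irr W 3 := hasIrreducibleModPGaloisRep_of_hasSurjectiveModNGaloisRep W 3 hsurj
  exact Visible.missingLowerBoundAt_three_of_congr_of_places₇ hU hU2 hCT W W' θ hθ S T hTS
    (good_and_not_mem_of_not_mem_placeFinset hE hF L Nat.prime_three h3L hΔE hΔF hS) hfin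
    (coprime_natCard_point_of_irr W 3 hirr) hT (fun w hw hwT ↦ hplaces w ((hS w).mp hw) (hT3 w hw hwT))
    hSha hq hv

end Summit.BirchSwinnertonDyer.Rank1Residual.Additive

end
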